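import Summits.QuantumFields.YangMills.Theorems.BalabanUVNodesN19DecorrelationLetterDualForm
import Mathlib.Analysis.Convex.SpecificFunctions.Basic
import Mathlib.Analysis.Convex.Jensen

/-!
# YM-DAG node N19 (= NE7 proper) — DICTIONARY between the response road's decorrelation letter (DC) and the hellinger road's RESPONSE letter (R): (DC) is the
# source-shift of the log-MGF of the two-run LOG-CONTRAST `h_0 = log B_0 − log A_0` under run A's class law (FILE F), (R) is — up to (RM) — the source-shift of
# its MEAN; Jensen + the contrast band squeeze `E_p[h] ≤ log E_p[e^h] ≤ max h`, so the two letters agree up to `2·(band width)` (+ `r` from (RM)): the two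
# crux roads carry THE SAME second letter for a bounded contrast, and NEITHER bound survives an EXTENSIVE contrast band (there FILE D §4 ∕ G ∕ H's aging is the road)

Cell `pub-ymgap`, HUMAN RULING D-0062 (Track A), width seat `pub-ymgap-dag-n19-w2` (node n19 = NE7), generation g7 (R455 (A) rule (ii); CLAIM-9 on the cell
bus).  Route `Summits/QuantumFields/YangMills/Theses/BalabanUVNodes.lean`, key item K3⁸ `SpineGivenEndpointR13SepCoPHV` (stmt-QuantumFields-27366; aside
predecessor K3⁷ 20544); filed `--kind proof --supports … --as helper`.  COUNT-NEUTRAL.  THEOREMS ONLY (0 `def`, 0 `sorry`).  ADDITIVE — imports this seat's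
FILE F `…N19DecorrelationLetterDualForm` (p629625: `decorrelation_eq_contrastMeanShift`) and Mathlib's Jensen (`ConvexOn.map_sum_le`, `convexOn_exp`); modifies nothing.

CONTEXT.  The crux card `hellinger-free-energy-road` (idea-3; kernel in dag-n19-w4 `…N19ClassMeanResponseCalculus`, dag-n20-w4 `…N20InterpolatedClassFreeEnergy`)
reads node U5's target from a VARIANCE letter (V) and a RESPONSE letter (R) «`|⟨h_{K,t}⟩_{p_{K,t}} − ⟨h_{K,0}⟩_{p_{K,0}}|` summable», `h_t = log B_t − log A_t`, `p_t ∝ A_t`.  This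
seat's road (FILES C–J) reads it from (RM) + (DC).  THIS FILE is the dictionary: under (RM) (`h_t = h_0 ± r` classwise) (R) is within `r` of the MEAN-SHIFT of the
source-free log-contrast `h_0` under run A's law from source `0` to source `t` (§1); (DC) IS the shift of its LOG-MGF (FILE F's dual form); and for any probability
vector Jensen gives `E_p[h] ≤ log E_p[e^h] ≤ max h` (§2), so with a contrast band `m ≤ h_0 ≤ M` the two shifts differ by at most `2(M − m)` (§3).  Hence: BOUNDED
contrast ⇒ the two roads' second letters are interchangeable up to `O(M − m + r)`; EXTENSIVE contrast (`M − m = n_K D_0`, window-key-core) ⇒ neither letter is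
controlled this way, and the aging ∕ conditional-blindness source (D §4, G, H) is what either road must use.

WHAT IS KERNEL-CHECKED ([folklore] finite sums + Mathlib's Jensen).
* §1 `abs_meanShift_sub_meanShift_le_of_responseMatching` — (RM) ⇒ `|[E_{p_t}h_t − E_{p_0}h_0] − [E_{p_t}h_0 − E_{p_0}h_0]| ≤ r`.
* §2 `mean_le_log_mean_exp` (Jensen: `Σ p h ≤ log Σ p e^{h}` for a probability vector) · `log_mean_exp_le_sup` (`log Σ p e^h ≤ M` if `h ≤ M`) ·
  ★ `abs_log_mean_exp_sub_mean_le_band` (`|log Σ p e^h − Σ p h| ≤ M − m` for `h ∈ [m, M]`).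
* §3 ★★ `abs_decorrelation_sub_logContrastMeanShift_le` — positive weights, contrast band `m ≤ log B_0 − log A_0 ≤ M` ⇒ `|(DC)-expression − [E_{p_t}h_0 − E_{p_0}h_0]| ≤ 2(M − m)`
  with `p_s := A_s ∕ Σ A_s` (FILE F's `decorrelation_eq_contrastMeanShift` + §2 twice).

HONEST FRAMING.  Elementary inequalities on hypothesis SHAPES; the band, (RM), (R), (DC) are produced by nobody for Bałaban's runs; NE7 NOT PRINTED for d = 4 ∕ NOT
proved; N19 NOT discharged; K3⁸ 27366 OPEN, not claimed — stub 2 is `Core`-typed and NOT served here; counts UNMOVED (typed 28∕28 · discharged 5∕27, A 5∕28); no count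
claim.  One finite four-torus programme at fixed ε; R4 closes the conditional finite-𝕋⁴ rung `BalabanLadder.UV` only — NOT the Yang–Mills mass gap, NOT the Clay problem.  0 `def`; 0 `sorry`.
-/

noncomputable section

open Finset
open scoped BigOperators

namespace Summit.QuantumFields.YangMills.BalabanUVNodes.N19ResponseRoadHellingerDictionary

open Summit.QuantumFields.YangMills.BalabanUVNodes.N19DecorrelationLetterDualForm (decorrelation_eq_contrastMeanShift)

variable {ι : Type*} {T : Finset ι}

/-! ## §1 Under (RM) the hellinger road's response letter is the mean-shift of the source-free log-contrast -/

/-- **(RM) ⇒ (R) = MEAN-SHIFT OF `h_0`, up to `r`.**  Two probability vectors `p_t`, `p_0` on `T` and log-contrasts `h_t`, `h_0` with `|h_t − h_0| ≤ r` classwise ((RM)) ⇒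
`|[Σ p_t h_t − Σ p_0 h_0] − [Σ p_t h_0 − Σ p_0 h_0]| ≤ r`. [folklore] -/
theorem abs_meanShift_sub_meanShift_le_of_responseMatching {pt p0 ht h0 : ι → ℝ} {r : ℝ} (hpt : ∀ τ ∈ T, 0 ≤ pt τ) (hpt1 : ∑ τ ∈ T, pt τ = 1)
    (hRM : ∀ τ ∈ T, |ht τ - h0 τ| ≤ r) :
    |(∑ τ ∈ T, pt τ * ht τ - ∑ τ ∈ T, p0 τ * h0 τ) - (∑ τ ∈ T, pt τ * h0 τ - ∑ τ ∈ T, p0 τ * h0 τ)| ≤ r := by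
  have e : (∑ τ ∈ T, pt τ * ht τ - ∑ τ ∈ T, p0 τ * h0 τ) - (∑ τ ∈ T, pt τ * h0 τ - ∑ τ ∈ T, p0 τ * h0 τ) =
      ∑ τ ∈ T, pt τ * (ht τ - h0 τ) := by
    rw [show (∑ τ ∈ T, pt τ * ht τ - ∑ τ ∈ T, p0 τ * h0 τ) - (∑ τ ∈ T, pt τ * h0 τ - ∑ τ ∈ T, p0 τ * h0 τ) =
        ∑ τ ∈ T, pt τ * ht τ - ∑ τ ∈ T, pt τ * h0 τ by ring, ← Finset.sum_sub_distrib]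
    exact Finset.sum_congr rfl fun τ _ => by ring
  rw [e]
  calc |∑ τ ∈ T, pt τ * (ht τ - h0 τ)| ≤ ∑ τ ∈ T, |pt τ * (ht τ - h0 τ)| := Finset.abs_sum_le_sum_abs _ _
    _ = ∑ τ ∈ T, pt τ * |ht τ - h0 τ| := Finset.sum_congr rfl fun τ hτ => by rw [abs_mul, abs_of_nonneg (hpt τ hτ)]
    _ ≤ ∑ τ ∈ T, pt τ * r := Finset.sum_le_sum fun τ hτ => mul_le_mul_of_nonneg_left (hRM τ hτ) (hpt τ hτ)
    _ = r := by rw [← Finset.sum_mul, hpt1, one_mul]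

/-! ## §2 Jensen and the band: `E_p[h] ≤ log E_p[e^h] ≤ max h` -/

/-- **JENSEN** (Mathlib `ConvexOn.map_sum_le` for `exp`): for a probability vector `p` on `T`, `Σ p h ≤ log Σ p e^{h}`. [folklore] -/
theorem mean_le_log_mean_exp {p h : ι → ℝ} (hp : ∀ τ ∈ T, 0 ≤ p τ) (hp1 : ∑ τ ∈ T, p τ = 1) :
    ∑ τ ∈ T, p τ * h τ ≤ Real.log (∑ τ ∈ T, p τ * Real.exp (h τ)) := by
  have hJ := ConvexOn.map_sum_le (t := T) (w := p) (p := h) convexOn_exp hp hp1 (fun _ _ => Set.mem_univ _)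
  simp only [smul_eq_mul] at hJ
  have hpos : 0 < ∑ τ ∈ T, p τ * Real.exp (h τ) := by
    -- some weight is positive since they sum to one
    obtain ⟨τ₀, hτ₀, hpτ₀⟩ := Finset.exists_ne_zero_of_sum_ne_zero (by rw [hp1]; exact one_ne_zero : ∑ τ ∈ T, p τ ≠ 0)
    exact lt_of_lt_of_le (mul_pos (lt_of_le_of_ne (hp τ₀ hτ₀) (Ne.symm hpτ₀)) (Real.exp_pos _))
      (Finset.single_le_sum (f := fun τ => p τ * Real.exp (h τ)) (fun τ hτ => mul_nonneg (hp τ hτ) (Real.exp_nonneg _)) hτ₀)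
  rw [← Real.exp_le_exp, Real.exp_log hpos]
  exact hJ

/-- **THE BAND ABOVE**: `h ≤ M` on `T` ⇒ `log Σ p e^{h} ≤ M` for a probability vector `p`. [folklore] -/
theorem log_mean_exp_le_sup {p h : ι → ℝ} {M : ℝ} (hp : ∀ τ ∈ T, 0 ≤ p τ) (hp1 : ∑ τ ∈ T, p τ = 1) (hM : ∀ τ ∈ T, h τ ≤ M) :
    Real.log (∑ τ ∈ T, p τ * Real.exp (h τ)) ≤ M := by
  have hle : ∑ τ ∈ T, p τ * Real.exp (h τ) ≤ Real.exp M := by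
    calc ∑ τ ∈ T, p τ * Real.exp (h τ) ≤ ∑ τ ∈ T, p τ * Real.exp M :=
          Finset.sum_le_sum fun τ hτ => mul_le_mul_of_nonneg_left (Real.exp_le_exp.2 (hM τ hτ)) (hp τ hτ)
      _ = Real.exp M := by rw [← Finset.sum_mul, hp1, one_mul]
  obtain ⟨τ₀, hτ₀, hpτ₀⟩ := Finset.exists_ne_zero_of_sum_ne_zero (by rw [hp1]; exact one_ne_zero : ∑ τ ∈ T, p τ ≠ 0)
  have hpos : 0 < ∑ τ ∈ T, p τ * Real.exp (h τ) := lt_of_lt_of_le (mul_pos (lt_of_le_of_ne (hp τ₀ hτ₀) (Ne.symm hpτ₀)) (Real.exp_pos _))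
    (Finset.single_le_sum (f := fun τ => p τ * Real.exp (h τ)) (fun τ hτ => mul_nonneg (hp τ hτ) (Real.exp_nonneg _)) hτ₀)
  calc Real.log (∑ τ ∈ T, p τ * Real.exp (h τ)) ≤ Real.log (Real.exp M) := Real.log_le_log hpos hle
    _ = M := Real.log_exp M

/-- **LOG-MGF VERSUS MEAN UNDER A BAND**: `m ≤ h ≤ M` on `T`, `p` a probability vector ⇒ `|log Σ p e^{h} − Σ p h| ≤ M − m` (Jensen below, the band above; the sharp
Hoeffding constant `(M−m)²∕8` is not needed here). [folklore] -/
theorem abs_log_mean_exp_sub_mean_le_band {p h : ι → ℝ} {m M : ℝ} (hp : ∀ τ ∈ T, 0 ≤ p τ) (hp1 : ∑ τ ∈ T, p τ = 1)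
    (hm : ∀ τ ∈ T, m ≤ h τ) (hM : ∀ τ ∈ T, h τ ≤ M) :
    |Real.log (∑ τ ∈ T, p τ * Real.exp (h τ)) - ∑ τ ∈ T, p τ * h τ| ≤ M - m := by
  have h1 := mean_le_log_mean_exp (h := h) hp hp1
  have h2 := log_mean_exp_le_sup hp hp1 hM
  have h3 : m ≤ ∑ τ ∈ T, p τ * h τ := by
    calc m = ∑ τ ∈ T, p τ * m := by rw [← Finset.sum_mul, hp1, one_mul]
      _ ≤ ∑ τ ∈ T, p τ * h τ := Finset.sum_le_sum fun τ hτ => mul_le_mul_of_nonneg_left (hm τ hτ) (hp τ hτ)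
  rw [abs_le]; constructor <;> linarith

/-! ## §3 (DC) versus the mean-shift of the log-contrast: the two roads' second letters agree up to `2·(band width)` -/

variable {A B : ℝ → ι → ℝ} {l₀ : ℝ}

/-- **(DC) − (mean-shift of `h_0`) is `O(band)`.**  Positive run-A weights on a nonempty `T` for `|s| ≤ l₀` (`0 ≤ l₀`), positive `B_0`, and a log-contrast band
`m ≤ log B_0 τ − log A_0 τ ≤ M`.  With the normalised laws `p_s := A_s ∕ Σ_T A_s`: `|(DC)-expression(t) − [Σ p_t h_0 − Σ p_0 h_0]| ≤ 2(M − m)` — FILE F's dual form writes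
(DC) as `log E_{p_t}[e^{h_0}] − log E_{p_0}[e^{h_0}]`, and §2 compares each log-MGF with the corresponding mean.  So for a BOUNDED contrast the response road's (DC) and the
hellinger road's (R) (via §1) differ by `O(M − m + r)`; for an EXTENSIVE contrast neither is controlled this way. [folklore] -/
theorem abs_decorrelation_sub_logContrastMeanShift_le (hT : T.Nonempty) (hA : ∀ s, |s| ≤ l₀ → ∀ τ ∈ T, 0 < A s τ) (hB0 : ∀ τ ∈ T, 0 < B 0 τ)
    (hl₀ : 0 ≤ l₀) {m M : ℝ} (hm : ∀ τ ∈ T, m ≤ Real.log (B 0 τ) - Real.log (A 0 τ)) (hM : ∀ τ ∈ T, Real.log (B 0 τ) - Real.log (A 0 τ) ≤ M)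
    {t : ℝ} (ht : |t| ≤ l₀) :
    |(Real.log (∑ τ ∈ T, B 0 τ * (A t τ / A 0 τ)) - Real.log (∑ τ ∈ T, B 0 τ) -
        (Real.log (∑ τ ∈ T, A t τ) - Real.log (∑ τ ∈ T, A 0 τ))) -
      ((∑ τ ∈ T, A t τ / (∑ σ ∈ T, A t σ) * (Real.log (B 0 τ) - Real.log (A 0 τ))) -
        ∑ τ ∈ T, A 0 τ / (∑ σ ∈ T, A 0 σ) * (Real.log (B 0 τ) - Real.log (A 0 τ)))| ≤ 2 * (M - m) := by
  have h0 : |(0 : ℝ)| ≤ l₀ := by simpa using hl₀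
  rw [decorrelation_eq_contrastMeanShift (fun τ hτ => hA 0 h0 τ hτ) t]
  -- per source value `s`: log-MGF of `h_0` under `p_s` versus its mean, with `e^{h_0} = B_0/A_0`
  have key : ∀ s, |s| ≤ l₀ →
      |(Real.log (∑ τ ∈ T, A s τ * (B 0 τ / A 0 τ)) - Real.log (∑ τ ∈ T, A s τ)) -
        ∑ τ ∈ T, A s τ / (∑ σ ∈ T, A s σ) * (Real.log (B 0 τ) - Real.log (A 0 τ))| ≤ M - m := by
    intro s hs
    have hS : 0 < ∑ σ ∈ T, A s σ := Finset.sum_pos (fun τ hτ => hA s hs τ hτ) hT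
    have hp : ∀ τ ∈ T, 0 ≤ A s τ / ∑ σ ∈ T, A s σ := fun τ hτ => (div_pos (hA s hs τ hτ) hS).le
    have hp1 : ∑ τ ∈ T, A s τ / ∑ σ ∈ T, A s σ = 1 := by rw [← Finset.sum_div, div_self hS.ne']
    have hband := abs_log_mean_exp_sub_mean_le_band (h := fun τ => Real.log (B 0 τ) - Real.log (A 0 τ)) hp hp1 hm hM
    -- identify `Σ p_s e^{h_0} = (Σ A_s · B_0/A_0) / Σ A_s`
    have hexp : ∀ τ ∈ T, Real.exp (Real.log (B 0 τ) - Real.log (A 0 τ)) = B 0 τ / A 0 τ := fun τ hτ => by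
      rw [Real.exp_sub, Real.exp_log (hB0 τ hτ), Real.exp_log (hA 0 h0 τ hτ)]
    have hsum : ∑ τ ∈ T, A s τ / (∑ σ ∈ T, A s σ) * Real.exp (Real.log (B 0 τ) - Real.log (A 0 τ)) =
        (∑ τ ∈ T, A s τ * (B 0 τ / A 0 τ)) / ∑ σ ∈ T, A s σ := by
      rw [Finset.sum_div]
      exact Finset.sum_congr rfl fun τ hτ => by rw [hexp τ hτ]; ring
    have hpos : 0 < ∑ τ ∈ T, A s τ * (B 0 τ / A 0 τ) :=
      Finset.sum_pos (fun τ hτ => mul_pos (hA s hs τ hτ) (div_pos (hB0 τ hτ) (hA 0 h0 τ hτ))) hT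
    rw [hsum, Real.log_div hpos.ne' hS.ne'] at hband
    exact hband
  have kt := key t ht
  have k0 := key 0 h0
  rw [abs_le] at kt k0 ⊢
  constructor <;> linarith [kt.1, kt.2, k0.1, k0.2]

end Summit.QuantumFields.YangMills.BalabanUVNodes.N19ResponseRoadHellingerDictionary

end
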